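import Mathlib
import Summits.Ventures.HodgeRepro2.T6NAut2

/-!
# T6NAut2View — the forgetful view of a v2 carrier as a v1 carrier over the period datum with
admissibility forgotten (TARGET-T6 v0.4 §9.2(b), v2 — the owners' side-level mains apply unchanged)

Cell pub-hodge-repro2, Tier 6 (README §10), seat t6-lead (gen 2). `NAut2 F P` (T6NAut2, p402224) has
no map to `NAut F P` over the SAME period datum (v1's unconditional richness is what v2 refuses to
assume). It does have one over the period datum with admissibility FORGOTTEN — `P.trivialAdm`
(`AdmChoice ≡ True`; same choices, shadows, `τ₁`, generators) — provided every quadruple of Schwartz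
data is the data of SOME choice (`hex`, admissible or not: the choices `c = (ν, K, (φ_i, q_i, p_i)_i)`
of TIER5 (N0.2)(q3)–(q5) carry arbitrary Schwartz data, so on the host `data` is a projection and
`hex` holds by construction). The view `M.toNAut' hex : NAut F P.trivialAdm` has `d3`, `sA`, `sB`,
`ι5`, `G5`, `d5` equal to `M`'s BY `rfl`, so the owners' SIDE-LEVEL v1 mains — N3A / N3B over `d3`
(t6-p3's `N3A_main` / `N3B_main`), N4 over `sA` / `sB` (t6-p4's `N4_main`) — apply to a v2 carrier
unchanged, and their conclusions `(M.toNAut' hex).iA` etc. ARE `M.iA` etc. (`toNAut'_iA` … are `rfl`).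
NOT for N1: the view's `d1` is the transported one and `AdmChoice ≡ True` would turn N1's displays
into assumptions on non-admissible choices — N1 is consumed on `M.d1` over the ORIGINAL `P`. What is
genuinely new at v2 is therefore only the isotypic step in its DATA form (an N2-ADMISSIBLE quadruple
with non-zero pairing) and N2 itself.

§8(d): uses an L-value-free non-vanishing device: NO.
-/

namespace Summit.Ventures.HodgeRepro2.T6

variable {K : Type*} [Field K] [NumberField K] [NumberField.IsCMField K]

/-- The period datum with admissibility FORGOTTEN: same choices, shadows, base embedding and
generators, `AdmChoice ≡ True`. The carrier of the forgetful view `NAut2.toNAut'`. -/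
def NDatum.trivialAdm {F : FaceSetting K} (P : NDatum F) : NDatum F :=
  { P with AdmChoice := fun _ => True }

namespace NAut2

variable {F : FaceSetting K} {P : NDatum F} (M : NAut2 F P)

/-- THE FORGETFUL VIEW: the v1 carrier over `P.trivialAdm`, given that every quadruple of Schwartz
data is the data of some choice (`hex`). Its `d3`, `sA`, `sB`, `ι5`, `G5`, `d5` are `M`'s by `rfl`. -/
def toNAut' (hex : ∀ (φa : M.d3.A.Sa) (φb : M.d3.A.Sb) (φc : M.d3.B.Sa) (φd : M.d3.B.Sb),
    ∃ c, M.data c = (φa, φb, φc, φd)) : NAut F P.trivialAdm where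
  d3 := M.d3
  data := M.data
  data_surj φa φb φc φd := (hex φa φb φc φd).imp fun _ h => ⟨trivial, h⟩
  d1 := { conj := M.d1.conj, conj_smul := M.d1.conj_smul, conj_conj := M.d1.conj_conj,
          H10 := M.d1.H10, sc := M.d1.sc, cK := M.d1.cK, cK_pos := M.d1.cK_pos }
  sA := M.sA
  sB := M.sB
  ι5 := M.ι5
  G5 := M.G5
  instG5 := M.instG5
  d5 := M.d5
  hypII_A_of_N5 := M.hypII_A_of_N5
  hypII_B_of_N5 := M.hypII_B_of_N5

variable (hex : ∀ (φa : M.d3.A.Sa) (φb : M.d3.A.Sb) (φc : M.d3.B.Sa) (φd : M.d3.B.Sb),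
    ∃ c, M.data c = (φa, φb, φc, φd))

/-- `toNAut'` keeps the N3 datum. -/
theorem toNAut'_d3 : (M.toNAut' hex).d3 = M.d3 := rfl

/-- `toNAut'` keeps the N4 data of side A. -/
theorem toNAut'_sA : (M.toNAut' hex).sA = M.sA := rfl

/-- `toNAut'` keeps the N4 data of side B. -/
theorem toNAut'_sB : (M.toNAut' hex).sB = M.sB := rfl

/-- `toNAut'` keeps the N5 datum. -/
theorem toNAut'_d5 : (M.toNAut' hex).d5 = M.d5 := rfl

/-- (i) on side A reads the same through `toNAut'`. -/
theorem toNAut'_iA : (M.toNAut' hex).iA = M.iA := rfl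

/-- (i) on side B reads the same through `toNAut'`. -/
theorem toNAut'_iB : (M.toNAut' hex).iB = M.iB := rfl

/-- (ii) on side A reads the same through `toNAut'`. -/
theorem toNAut'_iiA : (M.toNAut' hex).iiA = M.iiA := rfl

/-- (ii) on side B reads the same through `toNAut'`. -/
theorem toNAut'_iiB : (M.toNAut' hex).iiB = M.iiB := rfl

/-- `ℓ_A ≠ 0` reads the same through `toNAut'`. -/
theorem toNAut'_ellA : (M.toNAut' hex).ellA = M.ellA := rfl

/-- `ℓ_B ≠ 0` reads the same through `toNAut'`. -/
theorem toNAut'_ellB : (M.toNAut' hex).ellB = M.ellB := rfl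

/-- N4's conclusion reads the same through `toNAut'`. -/
theorem toNAut'_N4 : (M.toNAut' hex).N4 = M.N4 := rfl

/-- N5's conclusion reads the same through `toNAut'`. -/
theorem toNAut'_N5 : (M.toNAut' hex).N5 = M.N5 := rfl

/-- The pairing reads the same through `toNAut'`. -/
theorem toNAut'_pairing (c : P.Choice) : (M.toNAut' hex).pairing c = M.pairing c := rfl

/-- A v1 carrier's `data_surj` gives `hex` for the v2 carrier `ofNAut M₁ d2`. -/
theorem ofNAut_hex (M₁ : NAut F P) (d2 : N2Datum F P M₁.d3) :
    ∀ (φa : M₁.d3.A.Sa) (φb : M₁.d3.A.Sb) (φc : M₁.d3.B.Sa) (φd : M₁.d3.B.Sb),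
      ∃ c, (ofNAut M₁ d2).data c = (φa, φb, φc, φd) :=
  fun φa φb φc φd => (M₁.data_surj φa φb φc φd).imp fun _ h => h.2

end NAut2

end Summit.Ventures.HodgeRepro2.T6
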